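import Summits.ResolutionOfSingularities.ResolutionOfSingularities.Theorems.MarkedTransferCampaignW13CanonicalFeeds
import Literature.AlgebraicGeometry.Hironaka2017.Proofs.S04CharAlgebra.Thm4p1Holds
import Literature.AlgebraicGeometry.Hironaka2017.Proofs.S04CharAlgebra.Thm4p4Holds
import Literature.AlgebraicGeometry.Hironaka2017.Proofs.S04CharAlgebra.Thm4p5
import Literature.AlgebraicGeometry.Hironaka2017.Lib.AffinePAlgBridge
import HarnessLib

/-!
# [OURS · L1 W1.3] F7′ consumer table, ROW 3, kernel form: the bound `℘̃_flat` (positive degrees = the ALGEBRAIC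
# characteristic algebra `℘_alg(Ě, a)` = `Campaign.pAlgPiece`) IS Diff-stable and antitone — re-fed from the TREE THEOREMS
# Th 4.1 / Th 4.4 / Th 4.5 as typed (`Thm4_1_holds`, `Thm4_4_holds`, `pAlg_antitone`; all modulo []) (seat res-L1-s13-pv-1, g4)

LADDER-RESOLUTION rung L (rescue), cell `res-hironaka`, RESCUE-SEED slot W1.3 (architecture bypass, reading R-flat). The slot's F7′
CONSUMER TABLE OF RECORD (HOME/L/res-L1-s13-pv-1/F7PRIME-TABLE-OF-RECORD-W13.md, FINAL 2cd97bafa29367f9, scored 2/4 by res-adj-1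
08:50:43Z / res-plan-2 08:51:32Z, (b2″) NOT fired, director-resolution g4 08:53:24Z) carries ONE conditional cell — ROW 3 (Rem 5.4 p.26,
`S05NegativePart.Rem5_4`: the `ℤ`-graded, multiplicative, Diff-closed algebra `℘̃` the modules `𝔏_{e−i}(j)` live in; substitute feed
`Campaign.pTildeFlat K J b i`, p483384): «✓ multiplicativity + Diff-shift ON GENERATORS (p475548); Diff-stability of the INTEGRAL
CLOSURE = Villamayor 2008 (Rev. Mat. Iberoam. 24) — a published fact NOT in FACT-LIST §A/§B ⇒ CONDITIONAL». This file discharges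
that condition IN THE KERNEL, with no literature binder, from theorems that landed in the tree on 2026-08-27 (~08:23Z, res-D-lib-2
over res-D-lit-1's F-20d/F-21e = `Hironaka2005.FinitePresentationTheorem_holds` / `calP_eq_integralClosure_P_holds`):

* `S04CharAlgebra.Thm4_1_holds` (Proofs/S04CharAlgebra/Thm4p1Holds.lean) — the TYPED Th 4.1 p.17 l.20–30 holds outright: on an
  ambient `Z` over a perfect `K`, `E` standard, the geometric `℘(E, ·)` (row 003 `pAlg`) is a graded `O_Z`-subalgebra with (1) `J ⊂
  ℘(E,b)`, (2) «`Diff^{(μ)}_Z(℘(E,a)) ⊂ ℘(E,a−μ)` for all `0 ≤ μ < a`» (affine-locally, tree `Resolution.diffIdeal`), (3) integrally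
  closed;
* `S04CharAlgebra.Thm4_4_holds` (Thm4p4Holds.lean) — the TYPED Th 4.4 p.18 l.4–12: on every affine open `U`,
  `⊕_a ℘(E,a)(U) X^a = pAlgebraicRing K Γ(U) J(U) b` (geometric = ALGEBRAIC `℘`, the integral closure of `Γ(U)[⊕_{j<b} Diff^{(j)}J X^{b−j}]`);
* `S04CharAlgebra.pAlg_antitone` (Thm4p5.lean, res-D-brk-1) — Th 4.5 p.18 l.13–14 for the carrier: `℘(E,a) ⊆ ℘(E,c)` for `c ≤ a`.

Since W1.3's bound piece is BY DEFINITION the algebraic one (`Campaign.pAlgPiece K J b a := homogPiece (pAlgebraicRing K O J b) a`,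
v3 p468546), Th 4.4 identifies it with `℘(E,a)(U)` (`pAlgPiece_eq_pAlg_ideal`) and Th 4.1 (2) transfers verbatim
(`diffIdeal_pAlgPiece_le_of_isAmbient`); the polynomial chart `K[x_σ]` (`σ` finite) — where the slot's objects live (`𝒞_can`,
`CampaignW13RFlatCanonicalPos`, the specimens A/B/C/D, the surface families) — is the top affine open of the ambient `𝔸^σ_K`
(`Lib/AffinePAlgBridge`: `isAmbient_affineSpace`, `exists_algEquiv_ΓTop`), transported along `Γ(𝔸^σ, ⊤) ≃ₐ[K] K[x_σ]` with the
tree's `diffIdeal_map_algEquiv` and `algEquiv_mem_homogPiece_pAlgebraicRing` (`diffIdeal_pAlgPiece_le`).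

WHAT THIS CHANGES IN THE TABLE, SAID PLAINLY (prover's words, not a verdict — scoring is res-adj-1's / res-plan-2's): row 3 becomes
✓ KERNEL for all parameters of its honest scope (ambient `Z` over a PERFECT field of characteristic `p`, `E = (J,b)` standard; chart
form: `K` perfect, `σ` finite, `J ≠ 0`, `b ≥ 1`) — graded (`homogPiece_mul_le`), multiplicative (`W13.mul_mem_pAlgPiece`, p475548),
antitone and Diff-stable into every NON-NEGATIVE target degree (this file), integrally closed (row 4, p482662). The tally would read
3/4; rows 1 and 2(b) stay REFUTED on `𝒞_can` (p501051 p503083 p507090 p508341 p514228 p515380), so (b2″) (= 4/4) STILL does NOT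
fire and the register word is unchanged («W1.3 DEAD as §13 replacement, ALIVE as banked R-flat theorems»). The NEGATIVE target degrees
are `⊥` by design of the bypass and receive no Diff-images (a `ℤ`-indexed Diff-stability through degree `0` would force the collapse of
K1.1's barrier `NegativePartCollapseUnderDiffStability`); `pTildeFlat` is antitone on `ℤ_{≥0}` only (`⊤` at `0`, `⊥` below). Caveat of
record: nothing here bears on L-G4 / (127) (`KangarooShadeIncrease.Hauser2003_kangarooShadeIncrease`). The Villamayor 2008 NEED-FACT
noted in the table is thereby unnecessary for row 3 and is not filed.

HONEST FRAMING. Nothing here is a statement of H. Hironaka's manuscript *Resolution of singularities in positive characteristics*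
(2017-03-23, [Hironaka2017], lit key `paper:url-3343fd9e678b`): Th 4.1 / 4.4 / 4.5 and Rem 5.4 are CANDIDATES [claim: Hironaka2017,
status: under-review]; what is used is the kernel-checked truth of their TYPED readings (tree theorems about typed statements, themselves
resting on the tree's proofs of Hironaka 2005 [24]), and what is concluded is OURS bookkeeping about OUR bypass objects. Helper filed
`--supports stmt-ResolutionOfSingularities-15522`; PROOFS ONLY, no new objects. AI work, weaker than expert review; nothing here is
progress on resolution of singularities in positive characteristic.

CONTENTS (all `[folklore]`, sorry-free): §1 (every ambient `Z`) `pAlgPiece_eq_pAlg_ideal`, `diffIdeal_pAlgPiece_le_of_isAmbient`,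
`pAlgPiece_antitone_of_isAmbient`, `diffIdeal_pTildeFlat_le_of_isAmbient`; §2 (chart `K[x_σ]`) `diffIdeal_pAlgPiece_le`,
`pAlgPiece_zero_eq_top`, `pAlgPiece_antitone`; §3 (row 3's decl `pTildeFlat`) `diffIdeal_pTildeFlat_le`, `pTildeFlat_antitoneOn`.
-/

noncomputable section

set_option linter.dupNamespace false -- mandated namespace of this single-conjunct summit

namespace Summit.ResolutionOfSingularities.ResolutionOfSingularities.Theorems.Campaign.W13

open CategoryTheory
open _root_.AlgebraicGeometry
open Literature.AlgebraicGeometry.Resolution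
open Literature.AlgebraicGeometry.Hironaka2017
open Literature.AlgebraicGeometry.Hironaka2017.S02Preliminaries
open Literature.AlgebraicGeometry.Hironaka2017.S04CharAlgebra

universe u

/-! ## §1 Every ambient `Z`: the bound algebraic piece is the geometric `℘(E,a)(U)`, hence Diff-stable -/

section Ambient

variable {K : Type u} [Field K] {Z : Scheme.{u}} {p : ℕ} [Fact p.Prime] [CharP K p]

/-- **Geometric = bound algebraic, piece by piece.** On an ambient `Z` (§2 p.4 l.22–24: smooth, irreducible, of finite type over `K`,
`char K = p > 0`) over a PERFECT field `K`, for a standard `E = (J, b)` (`J ≠ 0`, `b ≥ 1`) and every affine open `U`: the slot's bound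
algebraic piece `℘_alg(Ě,a)(U) = Campaign.pAlgPiece K J(U) b a` (v3, the degree-`a` piece of row 003's `pAlgebraicRing`) EQUALS the
sections `℘(E,a)(U)` of the geometric carrier (row 003 `pAlg`). From the tree theorems `Thm4_4_holds` (typed Th 4.4 p.18 l.4–12) and
`Thm4_1_holds` (typed Th 4.1 p.17 l.20–30, for gradedness of `pAlg`), via `homogPiece_familySubalgebra`. [folklore] -/
theorem pAlgPiece_eq_pAlg_ideal {f : Z ⟶ Spec (.of K)} (hA : IsAmbient p f) (hK : PerfectField K)
    {E : IdealExponent Z} (hE : E.IsStandard) (U : Z.affineOpens) (a : ℕ) :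
    letI := sectionsAlgebra (kStructure f) U
    Campaign.pAlgPiece K (E.J.ideal U) E.b a = (pAlg E a).ideal U := by
  letI := sectionsAlgebra (kStructure f) U
  have h41 := (Thm4_1_holds (K := K) p f E hA hK hE).1
  have hgr : IsGradedOSubalgebra (pAlg E) := h41.1
  have hF0 : (pAlg E 0).ideal U = ⊤ := by rw [hgr.1]; rfl
  have hFmul : ∀ i j : ℕ, (pAlg E i).ideal U * (pAlg E j).ideal U ≤ (pAlg E (i + j)).ideal U := by
    intro i j
    have := (Scheme.IdealSheafData.le_def.mp (hgr.2 i j)) U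
    simpa [Scheme.IdealSheafData.ideal_mul] using this
  have h44 := Thm4_4_holds (K := K) p f E hA hK hE U
  show homogPiece _ (pAlgebraicRing K _ (E.J.ideal U) E.b) a = (pAlg E a).ideal U
  rw [← h44, homogPiece_familySubalgebra (fun n => (pAlg E n).ideal U) hF0 hFmul a]

/-- **F7′ ROW 3, ambient form — the bound `℘_alg` is Diff-stable.** On an ambient `Z` over a perfect `K`, `E = (J,b)` standard, every
affine open `U`, all `μ < a`: `Diff^{(μ)}(℘_alg(Ě,a)(U)) ⊆ ℘_alg(Ě,a−μ)(U)` for the tree's `Resolution.diffIdeal K μ` (values of ALL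
`K`-linear differential operators of order `≤ μ`, EGA IV₄ 16.8) — typed Th 4.1 (2) p.17 l.24–29 («`Diff^{(μ)}_Z(℘(E,a)) ⊂ ℘(E,a−μ)`
for all `0 ≤ μ < a`», `Thm4_1_2`) for the geometric `℘`, which `Thm4_1_holds` proves outright, moved to the algebraic piece by
`pAlgPiece_eq_pAlg_ideal`. This is the «Diff-stability of the integral closure» the table of record left CONDITIONAL on Villamayor 2008;
no literature binder remains. [folklore] -/
theorem diffIdeal_pAlgPiece_le_of_isAmbient {f : Z ⟶ Spec (.of K)} (hA : IsAmbient p f) (hK : PerfectField K)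
    {E : IdealExponent Z} (hE : E.IsStandard) (U : Z.affineOpens) {a μ : ℕ} (hμ : μ < a) :
    letI := sectionsAlgebra (kStructure f) U
    diffIdeal K μ (Campaign.pAlgPiece K (E.J.ideal U) E.b a) ≤ Campaign.pAlgPiece K (E.J.ideal U) E.b (a - μ) := by
  letI := sectionsAlgebra (kStructure f) U
  have h412 : Thm4_1_2 f (pAlg E) := (Thm4_1_holds (K := K) p f E hA hK hE).1.2.2.1
  have h := h412 U a μ hμ
  rw [pAlgPiece_eq_pAlg_ideal hA hK hE U a, pAlgPiece_eq_pAlg_ideal hA hK hE U (a - μ)]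
  exact h

/-- Ambient form of Th 4.5 p.18 l.13–14 for the bound algebraic pieces: `℘_alg(Ě,a)(U) ⊆ ℘_alg(Ě,c)(U)` for `c ≤ a` (tree
`pAlg_antitone`, moved by `pAlgPiece_eq_pAlg_ideal`). [folklore] -/
theorem pAlgPiece_antitone_of_isAmbient {f : Z ⟶ Spec (.of K)} (hA : IsAmbient p f) (hK : PerfectField K)
    {E : IdealExponent Z} (hE : E.IsStandard) (U : Z.affineOpens) {a c : ℕ} (hca : c ≤ a) :
    letI := sectionsAlgebra (kStructure f) U
    Campaign.pAlgPiece K (E.J.ideal U) E.b a ≤ Campaign.pAlgPiece K (E.J.ideal U) E.b c := by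
  letI := sectionsAlgebra (kStructure f) U
  rw [pAlgPiece_eq_pAlg_ideal hA hK hE U a, pAlgPiece_eq_pAlg_ideal hA hK hE U c]
  exact Scheme.IdealSheafData.le_def.mp (pAlg_antitone E hca) U

/-- **ROW 3 on its decl of record, ambient form.** The `ℤ`-family `Campaign.pTildeFlat K J(U) b` (p483384: `℘_alg` above `0`, `⊤` at `0`,
`⊥` below — the vacated slot) is Diff-stable into every NON-NEGATIVE target degree: `Diff^{(μ)}(℘̃_flat(i)) ⊆ ℘̃_flat(i − μ)` whenever
`μ ≤ i` (target `0` is everything; targets `> 0` by `diffIdeal_pAlgPiece_le_of_isAmbient`). Scope said plainly: for `μ > i` the target is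
`⊥` and the inclusion is NOT claimed (and is false in general) — the bypass vacates the negative degrees by design. [folklore] -/
theorem diffIdeal_pTildeFlat_le_of_isAmbient {f : Z ⟶ Spec (.of K)} (hA : IsAmbient p f) (hK : PerfectField K)
    {E : IdealExponent Z} (hE : E.IsStandard) (U : Z.affineOpens) {i : ℤ} {μ : ℕ} (hμ : (μ : ℤ) ≤ i) :
    letI := sectionsAlgebra (kStructure f) U
    diffIdeal K μ (Campaign.pTildeFlat K (E.J.ideal U) E.b i) ≤ Campaign.pTildeFlat K (E.J.ideal U) E.b (i - μ) := by
  letI := sectionsAlgebra (kStructure f) U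
  rcases hμ.eq_or_lt with h | h
  · rw [← h, sub_self, Campaign.pTildeFlat_zero]
    exact le_top
  · have hi : 0 < i := lt_of_le_of_lt (Int.natCast_nonneg μ) h
    have hiμ : 0 < i - μ := by omega
    rw [Campaign.pTildeFlat_of_pos K _ _ hi, Campaign.pTildeFlat_of_pos K _ _ hiμ,
      show (i - (μ : ℤ)).toNat = i.toNat - μ by omega]
    exact diffIdeal_pAlgPiece_le_of_isAmbient hA hK hE U (by omega)

end Ambient

/-! ## §2 The polynomial chart `K[x_σ]` (`σ` finite, `K` perfect of characteristic `p`): `℘_alg(J, b)` is Diff-stable -/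

section Chart

open MvPolynomial
open Literature.AlgebraicGeometry.Hironaka2017.SpecOrders
open Literature.AlgebraicGeometry.Hironaka2017.S04CharAlgebra.AffinePAlg

variable {K : Type} [Field K] {σ : Type} [Finite σ]

/-- **F7′ ROW 3, chart form — `℘_alg(J,b)` on `K[x_σ]` is Diff-stable.** `K` a perfect field of characteristic `p`, `σ` finite, `J ≠ 0`
an ideal of `K[x_σ]`, `b ≥ 1`: for all `μ < a`, `Diff^{(μ)}_K(℘_alg(J,b)(a)) ⊆ ℘_alg(J,b)(a − μ)` with `℘_alg(J,b)(a) = Campaign.pAlgPiece K J b a`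
(the degree-`a` piece of the integral closure in `K[x_σ][X]` of `K[x_σ][⊕_{j<b} Diff^{(j)}J · X^{b−j}]`) and `Diff^{(μ)}_K` the tree's
`Resolution.diffIdeal K μ` (on `K[x_σ]`, `σ` finite, these are the `K[x_σ]`-combinations of the Hasse–Schmidt derivatives `∂^{(α)}`,
`|α| ≤ μ`, tree `hasseSchmidtDiff_eq_diffOp_holds` — not used here). This is the chart on which the slot's objects live (`𝒞_can`,
`CampaignW13RFlatCanonicalPos`, specimens A/B/C/D/R2/E2, the surface families `g_p`). Proof: `K[x_σ]` is the top affine open of the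
ambient `𝔸^σ_K` (`isAmbient_affineSpace`), `E := (J~, b)` is standard, and the ambient form transports along `Γ(𝔸^σ_K, ⊤) ≃ₐ[K] K[x_σ]`
(`exists_algEquiv_ΓTop`) with `diffIdeal_map_algEquiv` and `algEquiv_mem_homogPiece_pAlgebraicRing`. No literature binder. [folklore] -/
theorem diffIdeal_pAlgPiece_le (p : ℕ) [Fact p.Prime] [CharP K p] [PerfectField K] {J : Ideal (MvPolynomial σ K)}
    (hJ : J ≠ ⊥) {b : ℕ} (hb : 0 < b) {a μ : ℕ} (hμ : μ < a) :
    diffIdeal K μ (Campaign.pAlgPiece K J b a) ≤ Campaign.pAlgPiece K J b (a - μ) := by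
  -- the affine space `𝔸^σ_K = Spec K[x_σ]`, its structure map, the datum `E = (J~, b)`, the top affine open
  set R := MvPolynomial σ K
  let f : Zs R ⟶ Spec (.of K) := Spec.map (CommRingCat.ofHom (algebraMap K R))
  let E : IdealExponent (Zs R) := ⟨shf R J, b⟩
  let U : (Zs R).affineOpens := ⟨⊤, isAffineOpen_top _⟩
  letI := sectionsAlgebra (kStructure f) U
  have hA : IsAmbient p f := isAmbient_affineSpace K σ p
  have hK : PerfectField K := inferInstance
  have hinj : Function.Injective (toΓ R) :=
    (ConcreteCategory.bijective_of_isIso (Scheme.ΓSpecIso (.of R)).inv).1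
  have hJU : E.J.ideal U = J.map (toΓ R) := shf_ideal_top R J
  have hE : E.IsStandard := by
    refine ⟨fun hbot => hJ ?_, hb⟩
    have h : E.J.ideal U = ⊥ := by
      rw [hbot, Scheme.IdealSheafData.ideal_bot, Pi.bot_apply]
    rw [hJU] at h
    exact (Ideal.map_eq_bot_iff_of_injective hinj).mp h
  -- §1 on the top affine open
  have h1 := diffIdeal_pAlgPiece_le_of_isAmbient hA hK hE U hμ
  -- transport along `Γ(𝔸^σ, ⊤) ≃ₐ[K] K[x_σ]`
  obtain ⟨e, he⟩ := exists_algEquiv_ΓTop K σ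
  have hJe : (E.J.ideal U).map e = J := by
    rw [hJU]
    apply le_antisymm
    · rw [Ideal.map_le_iff_le_comap, Ideal.map_le_iff_le_comap]
      intro r hr
      rw [Ideal.mem_comap, Ideal.mem_comap, he, ofΓ_toΓ]
      exact hr
    · intro r hr
      have hr' : r = e (toΓ R r) := by rw [he, ofΓ_toΓ]
      rw [hr']
      exact Ideal.mem_map_of_mem _ (Ideal.mem_map_of_mem _ hr)
  have hJe' : J.map e.symm = E.J.ideal U := by
    apply le_antisymm
    · rw [Ideal.map_le_iff_le_comap]
      intro r hr
      rw [← hJe] at hr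
      obtain ⟨c, hc, rfl⟩ := (Ideal.mem_map_of_equiv e r).1 hr
      rw [Ideal.mem_comap, e.symm_apply_apply]
      exact hc
    · intro c hc
      have hc' : c = e.symm (e c) := (e.symm_apply_apply c).symm
      rw [hc']
      refine Ideal.mem_map_of_mem _ ?_
      rw [← hJe]
      exact Ideal.mem_map_of_mem _ hc
  have hpiece : ∀ n : ℕ, (Campaign.pAlgPiece K (E.J.ideal U) b n).map e = Campaign.pAlgPiece K J b n := by
    intro n
    apply le_antisymm
    · rw [Ideal.map_le_iff_le_comap]
      intro c hc
      rw [Ideal.mem_comap]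
      have h := algEquiv_mem_homogPiece_pAlgebraicRing e (J := E.J.ideal U) (b := b) (a := n) hc
      rw [hJe] at h
      exact h
    · intro r hr
      have h := algEquiv_mem_homogPiece_pAlgebraicRing e.symm (J := J) (b := b) (a := n) hr
      rw [hJe'] at h
      have hr' : r = e (e.symm r) := (e.apply_symm_apply r).symm
      rw [hr']
      exact Ideal.mem_map_of_mem _ h
  rw [← hpiece a, ← hpiece (a - μ), ← diffIdeal_map_algEquiv]
  exact Ideal.map_mono h1

/-- The degree-`0` bound piece is everything (`℘_alg(J,b)(0) = O`: an `O`-subalgebra of `O[X]` contains `O`; tree `homogPiece_zero`).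
[folklore] -/
theorem pAlgPiece_zero_eq_top {O : Type} [CommRing O] [Algebra K O] (J : Ideal O) (b : ℕ) :
    Campaign.pAlgPiece K J b 0 = ⊤ :=
  homogPiece_zero _

/-- **Chart form of Th 4.5 for `℘_alg`**: on `K[x_σ]` (`K` perfect of characteristic `p`, `σ` finite, `J ≠ 0`, `b ≥ 1`) the bound pieces
decrease, `℘_alg(J,b)(a) ⊆ ℘_alg(J,b)(c)` for `c ≤ a` (from Diff-stability at the identity operator, order `0 ≤ a − c`, and
`℘_alg(J,b)(0) = ⊤`). [folklore] -/
theorem pAlgPiece_antitone (p : ℕ) [Fact p.Prime] [CharP K p] [PerfectField K] {J : Ideal (MvPolynomial σ K)}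
    (hJ : J ≠ ⊥) {b : ℕ} (hb : 0 < b) {a c : ℕ} (hca : c ≤ a) :
    Campaign.pAlgPiece K J b a ≤ Campaign.pAlgPiece K J b c := by
  rcases Nat.eq_zero_or_pos c with h0 | h0
  · rw [h0, pAlgPiece_zero_eq_top]
    exact le_top
  rcases hca.eq_or_lt with h | h
  · rw [h]
  · have h1 := diffIdeal_pAlgPiece_le p hJ hb (μ := a - c) (a := a) (by omega)
    rw [Nat.sub_sub_self hca] at h1
    exact (le_diffIdeal K (a - c) _).trans h1

end Chart

/-! ## §3 Row 3's decl of record: the `ℤ`-family `pTildeFlat` is Diff-stable into every NON-NEGATIVE target degree -/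

section PTilde

open MvPolynomial

variable {K : Type} [Field K] {σ : Type} [Finite σ]

/-- **F7′ ROW 3 on its decl of record `Campaign.pTildeFlat` (p483384), chart form.** On `K[x_σ]` (`K` perfect of characteristic `p`,
`σ` finite, `J ≠ 0`, `b ≥ 1`) the `ℤ`-family `℘̃_flat` — `℘_alg(J,b)(i)` for `i > 0`, `⊤` at `0`, `⊥` below — satisfies
`Diff^{(μ)}(℘̃_flat(i)) ⊆ ℘̃_flat(i − μ)` for all `μ ≤ i`: the Diff-closedness Rem 5.4 p.26 L18–L21 asks of `℘̃(E, ·)` in every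
NON-NEGATIVE target degree. NOT claimed (false in general) for `μ > i`, where the bypass's target is the vacated `⊥`; under the printed
`ℤ`-indexed Diff-stability through degree `0` the negative part collapses (K1.1's barrier `NegativePartCollapseUnderDiffStability`), which
is the defect the bypass routes around, not one it repairs. [folklore] -/
theorem diffIdeal_pTildeFlat_le (p : ℕ) [Fact p.Prime] [CharP K p] [PerfectField K] {J : Ideal (MvPolynomial σ K)}
    (hJ : J ≠ ⊥) {b : ℕ} (hb : 0 < b) {i : ℤ} {μ : ℕ} (hμ : (μ : ℤ) ≤ i) :
    diffIdeal K μ (Campaign.pTildeFlat K J b i) ≤ Campaign.pTildeFlat K J b (i - μ) := by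
  rcases hμ.eq_or_lt with h | h
  · -- target degree `0`: everything
    rw [← h, sub_self, Campaign.pTildeFlat_zero]
    exact le_top
  · have hi : 0 < i := lt_of_le_of_lt (Int.natCast_nonneg μ) h
    have hiμ : 0 < i - μ := by omega
    rw [Campaign.pTildeFlat_of_pos K J b hi, Campaign.pTildeFlat_of_pos K J b hiμ,
      show (i - (μ : ℤ)).toNat = i.toNat - μ by omega]
    exact diffIdeal_pAlgPiece_le p hJ hb (by omega)

/-- `℘̃_flat` is antitone on the non-negative degrees `ℤ_{≥0}` (`⊤` at `0`, then the decreasing `℘_alg(J,b)(i)`); it is NOT antitone on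
all of `ℤ` (`℘̃_flat(0) = ⊤ ⊄ ⊥ = ℘̃_flat(−1)`), said plainly. [folklore] -/
theorem pTildeFlat_antitoneOn (p : ℕ) [Fact p.Prime] [CharP K p] [PerfectField K] {J : Ideal (MvPolynomial σ K)}
    (hJ : J ≠ ⊥) {b : ℕ} (hb : 0 < b) : AntitoneOn (Campaign.pTildeFlat K J b) (Set.Ici 0) := by
  intro i hi j _ hij
  rcases (Set.mem_Ici.mp hi).eq_or_lt with h0 | h0
  · rw [← h0, Campaign.pTildeFlat_zero]
    exact le_top
  · have hj : 0 < j := lt_of_lt_of_le h0 hij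
    rw [Campaign.pTildeFlat_of_pos K J b h0, Campaign.pTildeFlat_of_pos K J b hj]
    exact pAlgPiece_antitone p hJ hb (by omega)

end PTilde

end Summit.ResolutionOfSingularities.ResolutionOfSingularities.Theorems.Campaign.W13

end
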